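import Mathlib.FieldTheory.ChevalleyWarning
import Mathlib.RingTheory.Ideal.Quotient.Basic
import Literature.NumberTheory.Automorphic.BrandtModule
import Literature.NumberTheory.Automorphic.QuaternionOrderIntegral
import Literature.NumberTheory.Automorphic.BrandtIndexReducedNorm
import HarnessLib

/-!
# The residue rings `O / d O` of a `ℤ`-order in a quaternion algebra over `ℚ`

Third layer of the proof files for the named fact `brandtMatrix_comm` of `BrandtModule.lean`
(Vignéras, LNM 800, Ch. III §5 exercice 5.8 (c)–(d); Eichler 1973, II §6 Thm. 2 (18)–(19)). The
same-prime Hecke relations between Brandt matrices rest on the structure of an Eichler order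
`O` *locally at a prime `p` not dividing the level*, which the printed sources read off the
completion (`O_p ≅ M₂(ℤ_p)` or the maximal order of the division algebra; Vignéras II §§1–2).
We replace completions by the finite residue rings `O / p^k O`; this file sets them up.

* `IsZOrder.subring hO` — the order as a `Subring B`; `IsZOrder.Residue hO d = O ⧸ d O` as a
  quotient *ring* (the ideal `d O` is two-sided, `d` being central), with the projection
  `IsZOrder.res hO d : O →+* O / d O`, its kernel (`res_eq_zero_iff`) and cardinality
  **`|O / d O| = d⁴`** in a quaternion algebra over `ℚ` (`IsZOrder.card_residue`, from
  `[O : d O] = nrd(d)² = d⁴`, `Brandt.cast_relIndex_units_smul_eq_reducedNorm_sq`).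
* `trdZ`, `nrdZ : B → ℤ` — the reduced trace and norm as integers (correct on integral
  elements, `cast_trdZ`, `cast_nrdZ`; Vignéras I §4 Lemme 4.1), the polar form
  `polZ x y = trdZ x · trdZ y − trdZ (x y)`, and the identities of Vignéras I §1 in integral
  form on an order: `x² = t(x) x − n(x)` (`mul_self_eq_trdZ`), `x x̄ = x̄ x = n(x)`,
  `n(xy) = n(x) n(y)`, `t(xy) = t(yx)`, **polarisation** `n(x + y) = n(x) + n(y) + polZ x y`
  (`nrdZ_add`), `x̄ ∈ O`, anti-multiplicativity of `x ↦ x̄`.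
* **Isotropy of the norm form modulo `p`** (`IsZOrder.exists_nrdZ_dvd_not_mem`): for every
  prime `p` there is `x ∈ O ∖ p O` with `p ∣ nrd(x)` — Chevalley–Warning
  (Mathlib `char_dvd_card_solutions`) for the quadratic form `nrd` in a `ℤ`-basis of `O`
  (`4 > 2` variables). This is the seed of the residual dichotomy "`O/pO` has a non-trivial
  idempotent or a non-trivial nilpotent" used to classify `O / p O` for maximal `O`
  (`BrandtModuleResidueStructure.lean`).

## References

* M.-F. Vignéras, *Arithmétique des algèbres de quaternions*, LNM 800 (1980), Ch. I §1
  (Lemme 1.1), §4 (Lemme 4.1), Ch. II §§1–2 [VignerasLNM800].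
* C. Chevalley, *Démonstration d'une hypothèse de M. Artin*, Abh. Math. Sem. Hamburg 11 (1935)
  — via Mathlib `FieldTheory.ChevalleyWarning` [folklore].
-/

noncomputable section

open scoped Pointwise
open MvPolynomial

universe u

namespace Literature.NumberTheory.Automorphic

/-! ### The order as a subring; the residue rings `O / d O` -/

namespace IsZOrder

section Ring

variable {B : Type u} [Ring B] {O : Submodule ℤ B}

/-- A `ℤ`-order as a subring of `B` (Vignéras I §4 Déf.: "un idéal qui est un anneau"). [cite: VignerasLNM800, Ch. I §4 Déf. p. 20 (ordre)] -/
def subring (hO : IsZOrder O) : Subring B where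
  carrier := O
  mul_mem' ha hb := hO.mul_mem _ ha _ hb
  one_mem' := hO.one_mem
  add_mem' ha hb := O.add_mem ha hb
  zero_mem' := O.zero_mem
  neg_mem' ha := O.neg_mem ha

/-- Membership in the subring of an order (definitional). [folklore] -/
@[simp] theorem mem_subring {hO : IsZOrder O} {x : B} : x ∈ hO.subring ↔ x ∈ O := Iff.rfl

/-- The ideal `d O` of the order `O` (as a left ideal of the subring; it is two-sided). [folklore] -/
def modIdeal (hO : IsZOrder O) (d : ℕ) : Ideal hO.subring := Ideal.span {(d : hO.subring)}

/-- `x ∈ d O ↔ x = d y` for some `y ∈ O`. [folklore] -/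
theorem mem_modIdeal_iff {hO : IsZOrder O} {d : ℕ} {x : hO.subring} :
    x ∈ hO.modIdeal d ↔ ∃ y : hO.subring, x = (d : hO.subring) * y := by
  rw [modIdeal, Ideal.mem_span_singleton']
  constructor
  · rintro ⟨a, rfl⟩
    exact ⟨a, (Nat.cast_commute d a).eq.symm⟩
  · rintro ⟨y, rfl⟩
    exact ⟨y, (Nat.cast_commute d y).eq.symm⟩

/-- `x ∈ d O ↔ x ∈ d • O` in `B`. [folklore] -/
theorem mem_modIdeal_iff_mem_smul {hO : IsZOrder O} {d : ℕ} {x : hO.subring} :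
    x ∈ hO.modIdeal d ↔ (x : B) ∈ (d : ℤ) • O := by
  rw [mem_modIdeal_iff, Submodule.mem_smul_pointwise_iff_exists]
  constructor
  · rintro ⟨y, rfl⟩
    exact ⟨y, y.2, by rw [Subring.coe_mul, Subring.coe_natCast, zsmul_eq_mul, Int.cast_natCast]⟩
  · rintro ⟨y, hy, hxy⟩
    refine ⟨⟨y, hy⟩, Subtype.ext ?_⟩
    rw [Subring.coe_mul, Subring.coe_natCast, ← hxy, zsmul_eq_mul, Int.cast_natCast]

/-- The ideal `d O` is two-sided (`d` is central). [folklore] -/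
instance isTwoSided_modIdeal (hO : IsZOrder O) (d : ℕ) : (hO.modIdeal d).IsTwoSided :=
  ⟨fun b ha => by
    obtain ⟨y, rfl⟩ := mem_modIdeal_iff.mp ha
    exact mem_modIdeal_iff.mpr ⟨y * b, by rw [mul_assoc]⟩⟩

/-- **The residue ring `O / d O`** of a `ℤ`-order, as a quotient ring of the subring `O` by the
two-sided ideal `d O`. For `d = p` prime this is the `𝔽_p`-algebra `O ⊗ 𝔽_p` whose structure
(matrix algebra or local) governs the Brandt matrices at `p` (Vignéras II §§1–2 read
residually). [cite: VignerasLNM800, Ch. II §§1–2] -/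
abbrev Residue (hO : IsZOrder O) (d : ℕ) : Type u := hO.subring ⧸ hO.modIdeal d

/-- The projection `O → O / d O`. [folklore] -/
def res (hO : IsZOrder O) (d : ℕ) : hO.subring →+* hO.Residue d := Ideal.Quotient.mk (hO.modIdeal d)

/-- The projection `O → O / d O` is onto. [folklore] -/
theorem res_surjective (hO : IsZOrder O) (d : ℕ) : Function.Surjective (hO.res d) :=
  Ideal.Quotient.mk_surjective

/-- **Kernel of the projection**: `res x = 0 ↔ x ∈ d • O`. [folklore] -/
theorem res_eq_zero_iff {hO : IsZOrder O} {d : ℕ} {x : hO.subring} :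
    hO.res d x = 0 ↔ (x : B) ∈ (d : ℤ) • O := by
  rw [res, Ideal.Quotient.eq_zero_iff_mem, mem_modIdeal_iff_mem_smul]

/-- `res x = res y ↔ x − y ∈ d • O`. [folklore] -/
theorem res_eq_res_iff {hO : IsZOrder O} {d : ℕ} {x y : hO.subring} :
    hO.res d x = hO.res d y ↔ (x : B) - y ∈ (d : ℤ) • O := by
  rw [res, Ideal.Quotient.eq, mem_modIdeal_iff_mem_smul]
  rfl

/-- `d = 0` in `O / d O`. [folklore] -/
@[simp] theorem res_natCast_self (hO : IsZOrder O) (d : ℕ) : hO.res d d = 0 :=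
  res_eq_zero_iff.mpr (Submodule.mem_smul_pointwise_iff_exists _ _ _ |>.mpr
    ⟨1, hO.one_mem, by rw [Subring.coe_natCast, zsmul_eq_mul, Int.cast_natCast, mul_one]⟩)

/-- `(d : O / d O) = 0`. [folklore] -/
@[simp] theorem natCast_self_residue (hO : IsZOrder O) (d : ℕ) : (d : hO.Residue d) = 0 := by
  rw [← map_natCast (hO.res d), res_natCast_self]

/-- **Cardinality of the residue ring via the index**: `|O / d O| = [O : d O]`. [folklore] -/
theorem card_residue_eq_relIndex (hO : IsZOrder O) (d : ℕ) :
    Nat.card (hO.Residue d) = ((d : ℤ) • O).toAddSubgroup.relIndex O.toAddSubgroup := by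
  have h1 : Nat.card (hO.Residue d) = (hO.modIdeal d).toAddSubgroup.index :=
    (AddSubgroup.index_eq_card _).symm
  have h2 : (hO.modIdeal d).toAddSubgroup =
      ((d : ℤ) • O).toAddSubgroup.comap (hO.subring.subtype : hO.subring →+ B) := by
    ext x
    exact mem_modIdeal_iff_mem_smul
  have h3 : (hO.subring.subtype : hO.subring →+ B).range = O.toAddSubgroup := by
    ext x
    constructor
    · rintro ⟨y, rfl⟩
      exact y.2
    · intro hx
      exact ⟨⟨x, hx⟩, rfl⟩
  rw [h1, h2, AddSubgroup.index_comap, h3]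

/-- `d • O = (d · 1) O` as lattices (integer multiples are left multiples by a unit `u = d · 1`). [folklore] -/
theorem natCast_smul_eq_units_smul (O : Submodule ℤ B) {d : ℕ} (u : Bˣ)
    (hu : (u : B) = (d : B)) : (d : ℤ) • O = u • O := by
  ext x
  rw [Submodule.mem_smul_pointwise_iff_exists, Units.smul_def, Submodule.mem_smul_pointwise_iff_exists]
  refine exists_congr fun y => and_congr_right fun _ => ?_
  rw [zsmul_eq_mul, Int.cast_natCast, smul_eq_mul, hu]

end Ring

/-! ### `|O / d O| = d⁴` in a quaternion algebra over `ℚ` -/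

section Quaternion

variable {B : Type u} [Ring B] [Algebra ℚ B] [IsQuaternionAlgebra ℚ B] {O : Submodule ℤ B}

/-- **`|O / d O| = d⁴`** for a `ℤ`-order in a quaternion algebra over `ℚ` and `d ≥ 1`:
`[O : d O] = nrd(d · 1)² = (d²)²` (`Brandt.cast_relIndex_units_smul_eq_reducedNorm_sq`). [cite: VignerasLNM800, Ch. I §1 (N = n²)] -/
theorem card_residue (hO : IsZOrder O) {d : ℕ} (hd : d ≠ 0) : Nat.card (hO.Residue d) = d ^ 4 := by
  have hdQ : (d : ℚ) ≠ 0 := by exact_mod_cast hd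
  have hunit : IsUnit (algebraMap ℚ B d) := (IsUnit.mk0 (d : ℚ) hdQ).map _
  obtain ⟨u, hu⟩ := hunit
  have hu' : (u : B) = (d : B) := by rw [hu, map_natCast]
  have hmem : (u : B) ∈ Brandt.leftOrder O := fun y hy => by
    rw [hu', ← Int.cast_natCast, ← zsmul_eq_mul]
    exact O.smul_mem _ hy
  have h := Brandt.cast_relIndex_units_smul_eq_reducedNorm_sq hO.isFullLattice hmem
  rw [hu, reducedNorm_algebraMap_rat, ← natCast_smul_eq_units_smul O u hu',
    ← card_residue_eq_relIndex hO d] at h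
  have h' : ((Nat.card (hO.Residue d) : ℕ) : ℚ) = ((d ^ 4 : ℕ) : ℚ) := by
    rw [h]; push_cast; ring
  exact_mod_cast h'

/-- The residue ring `O / d O`, `d ≥ 1`, is finite. [folklore] -/
theorem finite_residue (hO : IsZOrder O) {d : ℕ} (hd : d ≠ 0) : Finite (hO.Residue d) :=
  Nat.finite_of_card_ne_zero (by rw [hO.card_residue hd]; exact pow_ne_zero 4 hd)

/-- The residue ring `O / d O`, `d ≥ 2`, is non-trivial. [folklore] -/
theorem nontrivial_residue (hO : IsZOrder O) {d : ℕ} (hd : 1 < d) : Nontrivial (hO.Residue d) := by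
  haveI := hO.finite_residue (d := d) (by omega)
  rw [← Finite.one_lt_card_iff_nontrivial, hO.card_residue (by omega)]
  exact Nat.one_lt_pow (by norm_num) hd

end Quaternion

end IsZOrder

/-! ### Integral reduced trace and norm -/

section TrdNrd

variable {B : Type u} [Ring B] [Algebra ℚ B] [IsQuaternionAlgebra ℚ B]

/-- The reduced trace as an integer (the numerator of `trd x ∈ ℚ`; equal to `trd x` on integral
elements, `cast_trdZ`). [cite: VignerasLNM800, Ch. I §4 Lemme 4.1] -/
def trdZ (x : B) : ℤ := (reducedTrace ℚ B x).num

/-- The reduced norm as an integer (the numerator of `nrd x ∈ ℚ`; equal to `nrd x` on integral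
elements, `cast_nrdZ`). [cite: VignerasLNM800, Ch. I §4 Lemme 4.1] -/
def nrdZ (x : B) : ℤ := (reducedNorm ℚ B x).num

variable {O : Submodule ℤ B}

namespace IsZOrder

omit [Algebra ℚ B] [IsQuaternionAlgebra ℚ B] in
/-- Elements of a `ℤ`-order are integral. [cite: VignerasLNM800, Ch. I §4 Prop. 4.2] -/
theorem isIntegral (hO : IsZOrder O) {x : B} (hx : x ∈ O) : IsIntegral ℤ x :=
  isIntegral_int_of_mem_of_fg hO.one_mem hO.mul_mem hO.isFullLattice.1 hx

/-- **`trd x ∈ ℤ` on an order**: `(trdZ x : ℚ) = trd x` (Vignéras I §4 Lemme 4.1). [cite: VignerasLNM800, Ch. I §4 Lemme 4.1] -/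
theorem cast_trdZ (hO : IsZOrder O) {x : B} (hx : x ∈ O) : (trdZ x : ℚ) = reducedTrace ℚ B x := by
  obtain ⟨t, -, ht, -⟩ := exists_int_reducedTrace_reducedNorm_of_isIntegral (hO.isIntegral hx)
  rw [trdZ, ht, Rat.num_intCast]

/-- **`nrd x ∈ ℤ` on an order**: `(nrdZ x : ℚ) = nrd x` (Vignéras I §4 Lemme 4.1). [cite: VignerasLNM800, Ch. I §4 Lemme 4.1] -/
theorem cast_nrdZ (hO : IsZOrder O) {x : B} (hx : x ∈ O) : (nrdZ x : ℚ) = reducedNorm ℚ B x := by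
  obtain ⟨-, n, -, hn⟩ := exists_int_reducedTrace_reducedNorm_of_isIntegral (hO.isIntegral hx)
  rw [nrdZ, hn, Rat.num_intCast]

/-- `x̄ = trdZ x • 1 − x` on an order. [folklore] -/
theorem standardInvolution_eq (hO : IsZOrder O) {x : B} (hx : x ∈ O) :
    standardInvolution ℚ B x = (trdZ x : ℤ) • (1 : B) - x := by
  rw [standardInvolution, ← hO.cast_trdZ hx, Algebra.algebraMap_eq_smul_one, Int.cast_smul_eq_zsmul]

/-- **An order is stable under `x ↦ x̄`**. [cite: VignerasLNM800, Ch. I §4 Lemme 4.12] -/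
theorem standardInvolution_mem (hO : IsZOrder O) {x : B} (hx : x ∈ O) :
    standardInvolution ℚ B x ∈ O := by
  rw [hO.standardInvolution_eq hx]
  exact O.sub_mem (O.smul_mem _ hO.one_mem) hx

/-- **`x² = t(x) x − n(x)`** on an order, integrally (Vignéras I §1). [cite: VignerasLNM800, Ch. I §1 Lemme 1.1] -/
theorem mul_self_eq_trdZ (hO : IsZOrder O) {x : B} (hx : x ∈ O) :
    x * x = (trdZ x : ℤ) • x - (nrdZ x : ℤ) • (1 : B) := by
  rw [mul_self_eq_reducedTrace_mul_sub_reducedNorm ℚ B x, ← hO.cast_trdZ hx, ← hO.cast_nrdZ hx,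
    Algebra.algebraMap_eq_smul_one, Algebra.algebraMap_eq_smul_one, smul_mul_assoc, one_mul,
    Int.cast_smul_eq_zsmul, Int.cast_smul_eq_zsmul]

/-- **`x x̄ = n(x)`** on an order, integrally. [cite: VignerasLNM800, Ch. I §1 Lemme 1.1] -/
theorem mul_standardInvolution_eq (hO : IsZOrder O) {x : B} (hx : x ∈ O) :
    x * standardInvolution ℚ B x = (nrdZ x : ℤ) • (1 : B) := by
  rw [mul_standardInvolution_holds ℚ B x, ← hO.cast_nrdZ hx, Algebra.algebraMap_eq_smul_one,
    Int.cast_smul_eq_zsmul]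

/-- **`x̄ x = n(x)`** on an order, integrally. [cite: VignerasLNM800, Ch. I §1 Lemme 1.1] -/
theorem standardInvolution_mul_eq (hO : IsZOrder O) {x : B} (hx : x ∈ O) :
    standardInvolution ℚ B x * x = (nrdZ x : ℤ) • (1 : B) := by
  rw [IsQuaternionAlgebra.standardInvolution_mul, ← hO.cast_nrdZ hx, Algebra.algebraMap_eq_smul_one,
    Int.cast_smul_eq_zsmul]

/-- **Multiplicativity of the integral reduced norm** on an order. [cite: VignerasLNM800, Ch. I §1 Lemme 1.1] -/
theorem nrdZ_mul (hO : IsZOrder O) {x y : B} (hx : x ∈ O) (hy : y ∈ O) :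
    nrdZ (x * y) = nrdZ x * nrdZ y := by
  have h := reducedNorm_mul_holds ℚ B x y
  rw [← hO.cast_nrdZ hx, ← hO.cast_nrdZ hy, ← hO.cast_nrdZ (hO.mul_mem _ hx _ hy)] at h
  exact_mod_cast h

/-- Additivity of the integral reduced trace on an order. [folklore] -/
theorem trdZ_add (hO : IsZOrder O) {x y : B} (hx : x ∈ O) (hy : y ∈ O) :
    trdZ (x + y) = trdZ x + trdZ y := by
  have h : reducedTrace ℚ B (x + y) = reducedTrace ℚ B x + reducedTrace ℚ B y := map_add _ x y
  rw [← hO.cast_trdZ hx, ← hO.cast_trdZ hy, ← hO.cast_trdZ (O.add_mem hx hy)] at h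
  exact_mod_cast h

/-- `trd(k • x) = k trd(x)` integrally. [folklore] -/
theorem trdZ_zsmul (hO : IsZOrder O) (k : ℤ) {x : B} (hx : x ∈ O) : trdZ (k • x) = k * trdZ x := by
  have h : reducedTrace ℚ B (k • x) = (k : ℚ) * reducedTrace ℚ B x := by
    rw [← Int.cast_smul_eq_zsmul ℚ, map_smul, smul_eq_mul]
  rw [← hO.cast_trdZ hx, ← hO.cast_trdZ (O.smul_mem k hx)] at h
  exact_mod_cast h

/-- `nrd(k • x) = k² nrd(x)` integrally. [folklore] -/
theorem nrdZ_zsmul (hO : IsZOrder O) (k : ℤ) {x : B} (hx : x ∈ O) : nrdZ (k • x) = k ^ 2 * nrdZ x := by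
  have hk : (k : ℤ) • x = algebraMap ℚ B k * x := by
    rw [Algebra.algebraMap_eq_smul_one, smul_mul_assoc, one_mul, Int.cast_smul_eq_zsmul]
  have h := reducedNorm_mul_holds ℚ B (algebraMap ℚ B k) x
  rw [← hk, reducedNorm_algebraMap_rat, ← hO.cast_nrdZ hx, ← hO.cast_nrdZ (O.smul_mem k hx)] at h
  exact_mod_cast h

/-- `trd(1) = 2`. [folklore] -/
theorem trdZ_one : trdZ (1 : B) = 2 := by
  have h := reducedTrace_algebraMap_rat (D := B) 1
  rw [map_one, mul_one] at h
  rw [trdZ, h]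
  rfl

/-- `nrd(1) = 1`. [folklore] -/
theorem nrdZ_one : nrdZ (1 : B) = 1 := by
  rw [nrdZ, reducedNorm_one ℚ B]
  rfl

omit [IsQuaternionAlgebra ℚ B] in
/-- `nrd(0) = 0`. [folklore] -/
theorem nrdZ_zero : nrdZ (0 : B) = 0 := by
  rw [nrdZ, Brandt.reducedNorm_zero]
  rfl

omit [IsQuaternionAlgebra ℚ B] in
/-- **`trd(xy) = trd(yx)`** (the trace of `L_x L_y` equals that of `L_y L_x`). [cite: VignerasLNM800, Ch. I §1] -/
theorem trdZ_mul_comm (x y : B) : trdZ (x * y) = trdZ (y * x) := by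
  have h : reducedTrace ℚ B (x * y) = reducedTrace ℚ B (y * x) := by
    simp only [reducedTrace, LinearMap.smul_apply, leftMulTrace_apply, map_mul]
    rw [LinearMap.trace_mul_comm]
  rw [trdZ, trdZ, h]

/-- **The polar form** of the integral norm: `polZ x y = t(x) t(y) − t(xy)` (`= trd(x ȳ)`); it is
symmetric and satisfies `n(x + y) = n(x) + n(y) + polZ x y` on an order (`nrdZ_add`). [cite: VignerasLNM800, Ch. I §1] -/
def polZ (x y : B) : ℤ := trdZ x * trdZ y - trdZ (x * y)

omit [IsQuaternionAlgebra ℚ B] in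
/-- The polar form is symmetric. [folklore] -/
theorem polZ_comm (x y : B) : polZ x y = polZ y x := by
  rw [polZ, polZ, trdZ_mul_comm, mul_comm]

/-- **Polarisation** `n(x + y) = n(x) + n(y) + polZ x y` on an order: from three instances of
`z² = t(z) z − n(z)` one gets `xy + yx = t(x) y + t(y) x − (n(x+y) − n(x) − n(y))`, and taking
reduced traces (`trd(xy) = trd(yx)`, `trd 1 = 2`) identifies the scalar. [cite: VignerasLNM800, Ch. I §1 Lemme 1.1] -/
theorem nrdZ_add (hO : IsZOrder O) {x y : B} (hx : x ∈ O) (hy : y ∈ O) :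
    nrdZ (x + y) = nrdZ x + nrdZ y + polZ x y := by
  have hxy : x + y ∈ O := O.add_mem hx hy
  -- `xy + yx = t(x) y + t(y) x − N` with `N = n(x+y) − n(x) − n(y)`
  have key : x * y + y * x = (trdZ x : ℤ) • y + (trdZ y : ℤ) • x -
      ((nrdZ (x + y) - nrdZ x - nrdZ y : ℤ)) • (1 : B) := by
    have h1 := hO.mul_self_eq_trdZ hx
    have h2 := hO.mul_self_eq_trdZ hy
    have h3 := hO.mul_self_eq_trdZ hxy
    rw [hO.trdZ_add hx hy] at h3
    have : x * y + y * x = (x + y) * (x + y) - x * x - y * y := by noncomm_ring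
    rw [this, h1, h2, h3]
    simp only [smul_add, add_smul, sub_smul]
    abel
  -- take reduced traces
  have htr := congrArg trdZ key
  have hmem1 : (trdZ x : ℤ) • y + (trdZ y : ℤ) • x ∈ O := O.add_mem (O.smul_mem _ hy) (O.smul_mem _ hx)
  rw [hO.trdZ_add (hO.mul_mem _ hx _ hy) (hO.mul_mem _ hy _ hx), trdZ_mul_comm y x,
    sub_eq_add_neg, ← neg_smul, hO.trdZ_add hmem1 (O.smul_mem _ hO.one_mem),
    hO.trdZ_add (O.smul_mem _ hy) (O.smul_mem _ hx), hO.trdZ_zsmul _ hy, hO.trdZ_zsmul _ hx,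
    hO.trdZ_zsmul _ hO.one_mem, trdZ_one] at htr
  rw [polZ]
  linarith

/-- The polar form is additive in the second variable (on an order). [folklore] -/
theorem polZ_add_right (hO : IsZOrder O) {x y z : B} (hx : x ∈ O) (hy : y ∈ O) (hz : z ∈ O) :
    polZ x (y + z) = polZ x y + polZ x z := by
  simp only [polZ, mul_add, hO.trdZ_add hy hz, hO.trdZ_add (hO.mul_mem _ hx _ hy) (hO.mul_mem _ hx _ hz)]
  ring

/-- The polar form is homogeneous: `polZ (k • x) (l • y) = k l polZ x y`. [folklore] -/
theorem polZ_zsmul (hO : IsZOrder O) (k l : ℤ) {x y : B} (hx : x ∈ O) (hy : y ∈ O) :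
    polZ (k • x) (l • y) = k * l * polZ x y := by
  simp only [polZ, hO.trdZ_zsmul k hx, hO.trdZ_zsmul l hy, smul_mul_smul_comm,
    hO.trdZ_zsmul (k * l) (hO.mul_mem _ hx _ hy)]
  ring

/-- The polar form is additive in the first variable (on an order). [folklore] -/
theorem polZ_add_left (hO : IsZOrder O) {x y z : B} (hx : x ∈ O) (hy : y ∈ O) (hz : z ∈ O) :
    polZ (x + y) z = polZ x z + polZ y z := by
  rw [polZ_comm, hO.polZ_add_right hz hx hy, polZ_comm z x, polZ_comm z y]

/-- `polZ 0 y = 0`. [folklore] -/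
theorem polZ_zero_left (hO : IsZOrder O) {y : B} (hy : y ∈ O) : polZ 0 y = 0 := by
  have h := hO.polZ_zsmul 0 1 O.zero_mem hy
  rwa [zero_smul, one_smul, zero_mul, zero_mul] at h

/-- The polar form of a finite sum (in the first variable). [folklore] -/
theorem polZ_sum_left (hO : IsZOrder O) {ι : Type*} (s : Finset ι) (f : ι → B) (hf : ∀ i, f i ∈ O)
    {y : B} (hy : y ∈ O) : polZ (∑ i ∈ s, f i) y = ∑ i ∈ s, polZ (f i) y := by
  classical
  induction s using Finset.induction_on with
  | empty => rw [Finset.sum_empty, Finset.sum_empty, hO.polZ_zero_left hy]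
  | insert a s ha ih =>
    rw [Finset.sum_insert ha, Finset.sum_insert ha,
      hO.polZ_add_left (hf a) (O.sum_mem fun i _ => hf i) hy, ih]

/-- **The norm form in coordinates**: for `x₀, …, x_{n-1}` in an order,
`n(∑ xᵢ) = ∑ n(xᵢ) + ∑_{j < i} polZ x_j x_i`. [folklore] -/
theorem nrdZ_sum (hO : IsZOrder O) {n : ℕ} (g : Fin n → B) (hg : ∀ i, g i ∈ O) :
    nrdZ (∑ i, g i) = ∑ i, nrdZ (g i) + ∑ i, ∑ j, if j < i then polZ (g j) (g i) else 0 := by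
  induction n with
  | zero => simp [nrdZ_zero]
  | succ n ih =>
    have hS : ∑ i : Fin n, g (Fin.castSucc i) ∈ O := O.sum_mem fun i _ => hg _
    have hlast : ∑ j : Fin (n + 1), (if j < Fin.last n then polZ (g j) (g (Fin.last n)) else 0) =
        ∑ j : Fin n, polZ (g (Fin.castSucc j)) (g (Fin.last n)) := by
      rw [Fin.sum_univ_castSucc, if_neg (lt_irrefl _), add_zero]
      exact Finset.sum_congr rfl fun j _ => if_pos (Fin.castSucc_lt_last j)
    have hinner : ∀ i : Fin n,
        ∑ j : Fin (n + 1), (if j < Fin.castSucc i then polZ (g j) (g (Fin.castSucc i)) else 0) =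
          ∑ j : Fin n, if j < i then polZ (g (Fin.castSucc j)) (g (Fin.castSucc i)) else 0 := fun i => by
      rw [Fin.sum_univ_castSucc, if_neg (not_lt.mpr (Fin.castSucc_lt_last i).le), add_zero]
      exact Finset.sum_congr rfl fun j _ => by simp only [Fin.castSucc_lt_castSucc_iff]
    rw [Fin.sum_univ_castSucc g, hO.nrdZ_add hS (hg _), ih (fun i => g (Fin.castSucc i)) fun i => hg _,
      hO.polZ_sum_left _ _ (fun i => hg _) (hg _),
      Fin.sum_univ_castSucc (fun i => nrdZ (g i)),
      Fin.sum_univ_castSucc (fun i => ∑ j, if j < i then polZ (g j) (g i) else 0), hlast,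
      Finset.sum_congr rfl fun i _ => hinner i]
    ring

end IsZOrder

end TrdNrd

/-! ### Isotropy of the norm form modulo `p` (Chevalley–Warning) -/

section Isotropy

variable {B : Type u} [Ring B] [Algebra ℚ B] [IsQuaternionAlgebra ℚ B] {O : Submodule ℤ B}

/-- A `ℤ`-basis of an order, indexed by `Fin 4` (an order is a free `ℤ`-module, a `ℤ`-basis of a
full lattice being a `ℚ`-basis of the `4`-dimensional algebra). [folklore] -/
theorem IsZOrder.exists_basis_fin_four (hO : IsZOrder O) : Nonempty (Module.Basis (Fin 4) ℤ O) := by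
  haveI : Module.Finite ℤ O := Module.Finite.iff_fg.mpr hO.isFullLattice.1
  haveI : IsAddTorsionFree B := isAddTorsionFree_of_charZero_module ℚ B
  haveI : Module.Free ℤ O := Module.free_of_finite_type_torsion_free'
  haveI := isLocalizedModule_subtype_of_isFullLattice hO.isFullLattice
  let b := Module.Free.chooseBasis ℤ O
  let bQ : Module.Basis _ ℚ B := b.ofIsLocalizedModule ℚ (nonZeroDivisors ℤ) O.subtype
  have hcard : Fintype.card (Module.Free.ChooseBasisIndex ℤ O) = 4 := by
    rw [← Module.finrank_eq_card_basis bQ, IsQuaternionAlgebra.finrank_eq_four (K := ℚ) (D := B)]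
  exact ⟨b.reindex (Fintype.equivOfCardEq (by rw [hcard, Fintype.card_fin]))⟩

/-- **The norm form of an order is isotropic modulo every prime**: there is `x ∈ O`, `x ∉ p O`,
with `p ∣ nrd(x)` — Chevalley–Warning for the quadratic form `nrd(∑ vᵢ bᵢ)` in a `ℤ`-basis
`b` of `O` (a form of degree `2` in `4 > 2` variables over `𝔽_p` has a non-trivial zero). [folklore] -/
theorem IsZOrder.exists_nrdZ_dvd_not_mem (hO : IsZOrder O) {p : ℕ} (hp : p.Prime) :
    ∃ x ∈ O, x ∉ (p : ℤ) • O ∧ (p : ℤ) ∣ nrdZ x := by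
  classical
  haveI : Fact p.Prime := ⟨hp⟩
  obtain ⟨b⟩ := hO.exists_basis_fin_four
  have hb : ∀ i, ((b i : O) : B) ∈ O := fun i => (b i).2
  -- the quadratic form `nrd` in the coordinates `b`, reduced mod `p`
  let f : MvPolynomial (Fin 4) (ZMod p) :=
    ∑ i, C ((nrdZ ((b i : O) : B) : ZMod p)) * X i ^ 2 +
      ∑ i, ∑ j, if j < i then C ((polZ ((b j : O) : B) ((b i : O) : B) : ZMod p)) * X j * X i else 0
  have hdeg : f.totalDegree < Fintype.card (Fin 4) := by
    rw [Fintype.card_fin]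
    refine lt_of_le_of_lt ((totalDegree_add _ _).trans (max_le ?_ ?_)) (by norm_num : 2 < 4)
    · refine totalDegree_finsetSum_le fun i _ => (totalDegree_mul _ _).trans ?_
      rw [totalDegree_C, zero_add]
      exact (totalDegree_X_pow (R := ZMod p) i 2).le
    · refine totalDegree_finsetSum_le fun i _ => totalDegree_finsetSum_le fun j _ => ?_
      split_ifs
      · refine (totalDegree_mul _ _).trans ?_
        refine (add_le_add ((totalDegree_mul _ _).trans (add_le_add (totalDegree_C _).le
          (totalDegree_X (R := ZMod p) j).le)) (totalDegree_X (R := ZMod p) i).le).trans ?_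
        norm_num
      · rw [totalDegree_zero]; exact Nat.zero_le 2
  -- evaluating `f` at `v` is `nrd (∑ ṽᵢ bᵢ) mod p`
  have hval : ∀ v : Fin 4 → ZMod p, ∀ i, ((((v i).val : ℤ)) : ZMod p) = v i := fun v i => by
    rw [Int.cast_natCast, ZMod.natCast_zmod_val]
  have heval : ∀ v : Fin 4 → ZMod p,
      eval v f = ((nrdZ (∑ i, ((v i).val : ℤ) • ((b i : O) : B)) : ℤ) : ZMod p) := fun v => by
    rw [hO.nrdZ_sum _ fun i => O.smul_mem _ (hb i)]
    simp only [f, map_add, map_sum, hO.nrdZ_zsmul _ (hb _), hO.polZ_zsmul _ _ (hb _) (hb _)]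
    push_cast
    congr 1
    · refine Finset.sum_congr rfl fun i _ => ?_
      rw [map_mul, eval_C, map_pow, eval_X]
      simp only [ZMod.natCast_zmod_val]
      ring
    · refine Finset.sum_congr rfl fun i _ => Finset.sum_congr rfl fun j _ => ?_
      split_ifs
      · rw [map_mul, map_mul, eval_C, eval_X, eval_X]
        simp only [ZMod.natCast_zmod_val]
        ring
      · rw [map_zero]
  -- Chevalley–Warning: the number of zeros is divisible by `p`, and `0` is a zero
  have hdvd := char_dvd_card_solutions p hdeg
  have hzero : eval (0 : Fin 4 → ZMod p) f = 0 := by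
    rw [heval]; simp [IsZOrder.nrdZ_zero]
  have hcard : 1 < Fintype.card {v : Fin 4 → ZMod p // eval v f = 0} := by
    have hpos : 0 < Fintype.card {v : Fin 4 → ZMod p // eval v f = 0} :=
      Fintype.card_pos_iff.mpr ⟨⟨0, hzero⟩⟩
    exact lt_of_lt_of_le hp.one_lt (Nat.le_of_dvd hpos hdvd)
  obtain ⟨⟨v, hv⟩, hv0⟩ := Fintype.exists_ne_of_one_lt_card hcard ⟨0, hzero⟩
  have hv0' : v ≠ 0 := fun h => hv0 (Subtype.ext h)
  -- the candidate `x = ∑ ṽᵢ bᵢ`, an element of `O` with coordinates `ṽ`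
  let c : Fin 4 → ℤ := fun i => ((v i).val : ℤ)
  let xO : O := b.equivFun.symm c
  have hxO : (xO : B) = ∑ i, ((v i).val : ℤ) • ((b i : O) : B) := by
    simp only [xO, c, Module.Basis.equivFun_symm_apply, Submodule.coe_sum, Submodule.coe_smul]
  refine ⟨xO, xO.2, ?_, ?_⟩
  · -- not in `p O`: the coordinates are not all divisible by `p`
    intro hmem
    apply hv0'
    obtain ⟨y, hy, hxy⟩ := (Submodule.mem_smul_pointwise_iff_exists _ _ O).mp hmem
    have hxy' : xO = (p : ℤ) • (⟨y, hy⟩ : O) := Subtype.ext hxy.symm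
    have hc : c = (p : ℤ) • b.equivFun ⟨y, hy⟩ := by
      have h := congrArg b.equivFun hxy'
      rwa [map_zsmul, LinearEquiv.apply_symm_apply] at h
    funext i
    have hi : c i = (p : ℤ) * b.equivFun ⟨y, hy⟩ i := by rw [hc]; rfl
    have h : ((c i : ℤ) : ZMod p) = 0 := by
      rw [hi]; push_cast; simp
    rwa [hval] at h
  · rw [← ZMod.intCast_zmod_eq_zero_iff_dvd, hxO, ← heval, hv]

end Isotropy

end Literature.NumberTheory.Automorphic

end
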